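import Summits.HodgeConjecture.HodgeConjecture.Theorems.LinearSystemTorelliLocalTubeSpanThm29
import Mathlib.Tactic.Module

/-!
# Route LinearSystemTorelli — crux `LocalTubeSpan` (stmt-HodgeConjecture-2490): the square step of "all squares are monodromy"

Helper file (`--supports stmt-HodgeConjecture-2490`, line `Sketch` of the crux chain, cycle 9,
continuation lead c7; the lead's stub `stub_squares_step`, worker S0).

For an alternating form `B` on a `ℚ`-vector space `V` (`T_a v = v - B(v, a) a`, `skewTransvection`)
and a skew vanishing lattice `Δ` with monodromy group `Γ_Δ = transvectionGroup B Δ`, cycle 9 proves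
that EVERY square `T_a²` (`a ∈ ℤΔ`) lies in `Γ_Δ` by walking from `a` to `0` through elements of `Δ`
orthogonal to the current vector.  This file is the single step of that walk:

* `localTubeSpan_squares_step_exists_partner` — every `δ ∈ Δ` has a partner `y ∈ Δ`, `⟨δ, y⟩ = 1`
  (transport the pair of the definition by transitivity; `Γ_Δ` acts by isometries);
* `localTubeSpan_squares_step_pairMove_inv` — for `δ ∈ Δ` and a lattice vector `x ⟂ δ` some element
  of `Γ_Δ` acts as the INVERSE pair move `E_{δ,x}^{-2} : v ↦ v - 2(⟨v,δ⟩x + ⟨v,x⟩δ)`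
  (`localTubeSpan_pairMoves` + `localTubeSpan_pairMoves_neg`);
* `localTubeSpan_squares_step` — the registered stub: for `δ ∈ Δ`, `x ∈ ℤΔ`, `⟨δ, x⟩ = 0`, the square
  `T_x²` is realised in `Γ_Δ` iff `T_{x+δ}²` is.  MATHEMATICS: for `x ⟂ δ` the three maps `T_x`,
  `T_δ`, `E := (v ↦ v + ⟨v,x⟩δ + ⟨v,δ⟩x)` pairwise commute and `T_{x+δ} = T_x ∘ T_δ ∘ E⁻¹`, hence
  `T_{x+δ}² = T_x² ∘ T_δ² ∘ E⁻²`; both `T_δ²` (`localTubeSpan_sqMove_of_mem`) and `E^{±2}` (the pair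
  moves of `…Thm29`) lie in `Γ_Δ`.

No named facts; no `sorry`.
-/

-- `Summit.HodgeConjecture.HodgeConjecture.Theorems` is the mandated namespace (single-conjunct summit:
-- Sub = Summit), which `linter.dupNamespace` flags on every declaration; the lakefile turns the
-- linter off tree-wide (weak option), restated here so stand-alone elaboration is warning-free too.
set_option linter.dupNamespace false

noncomputable section

open Literature.AlgebraicGeometry.HodgeTheory

namespace Summit.HodgeConjecture.HodgeConjecture.Theorems

/-! ### The square step: `T_x² ∈ Γ_Δ ↔ T_{x+δ}² ∈ Γ_Δ` for `δ ∈ Δ`, `x ⟂ δ` -/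

section SquaresStep

variable {V : Type} [AddCommGroup V] [Module ℚ V]

/-- Every vanishing cycle `δ ∈ Δ` of a skew vanishing lattice has a partner `y ∈ Δ` with
`⟨δ, y⟩ = 1`: transport the pair `δ₁, δ₂` of the definition by an element of `Γ_Δ` moving `δ₁` to
`δ` (the monodromy group acts by isometries and preserves `Δ`). [folklore] -/
theorem localTubeSpan_squares_step_exists_partner (B : LinearMap.BilinForm ℚ V) (hB : B.IsAlt)
    (Δ : Set V) (hΔ : IsSkewVanishingLattice B Δ) {δ : V} (hδ : δ ∈ Δ) :
    ∃ y ∈ Δ, B δ y = 1 := by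
  obtain ⟨δ₁, hδ₁, δ₂, hδ₂, h12⟩ := hΔ.exists_pair
  obtain ⟨g, hg, hgδ⟩ := hΔ.transitive δ₁ hδ₁ δ hδ
  exact ⟨(g : V →ₗ[ℚ] V) δ₂, hΔ.stable g hg δ₂ hδ₂, by
    rw [← hgδ, localTubeSpan_transvectionGroup_isometry B hB Δ hg, h12]⟩

/-- **Inverse pair moves along a vanishing cycle are monodromy.**  For a skew vanishing lattice,
`δ ∈ Δ` and a lattice vector `x ∈ ℤΔ` with `⟨δ, x⟩ = 0`, some element of `Γ_Δ` acts as
`E_{δ,x}^{-2} : v ↦ v - 2(⟨v,δ⟩x + ⟨v,x⟩δ)` (the inverse of the pair move `E_{δ,x}²` of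
`localTubeSpan_pairMoves`, which is `E_{δ,-x}²`). [cite: Janssen1983, Thm. 2.5] -/
theorem localTubeSpan_squares_step_pairMove_inv (B : LinearMap.BilinForm ℚ V) (hB : B.IsAlt)
    (Δ : Set V) (hΔ : IsSkewVanishingLattice B Δ) {δ x : V} (hδ : δ ∈ Δ)
    (hx : x ∈ Submodule.span ℤ Δ) (hδx : B δ x = 0) :
    ∃ g ∈ transvectionGroup B Δ, ∀ v : V,
      ((g : (V →ₗ[ℚ] V)ˣ) : V →ₗ[ℚ] V) v = v - (2 : ℚ) • (B v δ • x + B v x • δ) := by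
  obtain ⟨y, hy, hδy⟩ := localTubeSpan_squares_step_exists_partner B hB Δ hΔ hδ
  obtain ⟨q, hq, hqv⟩ := localTubeSpan_pairMoves_neg B hB Δ hδx
    (localTubeSpan_pairMoves B hB Δ hΔ hδ hy hδy hx hδx)
  refine ⟨q, hq, fun v => ?_⟩
  rw [hqv, map_neg, smul_neg, neg_smul, ← neg_add, smul_neg, sub_eq_add_neg]

/-- **The square step of "all squares are monodromy".**  For a skew vanishing lattice `Δ` of an
alternating form, `δ ∈ Δ`, and a lattice vector `x ∈ ℤΔ` orthogonal to `δ`: some element of `Γ_Δ`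
acts as `T_x² : v ↦ v - 2⟨v, x⟩x` iff some element of `Γ_Δ` acts as `T_{x+δ}²`.  (For `x ⟂ δ`,
`T_{x+δ}² = T_x² ∘ T_δ² ∘ E_{δ,x}^{-2}` with the three factors pairwise commuting; `T_δ²` and
`E_{δ,x}^{±2}` lie in `Γ_Δ` by `localTubeSpan_sqMove_of_mem` and `localTubeSpan_pairMoves`.)
[cite: Janssen1983, Thm. 2.5] -/
theorem localTubeSpan_squares_step (B : LinearMap.BilinForm ℚ V) (hB : B.IsAlt) (Δ : Set V)
    (hΔ : IsSkewVanishingLattice B Δ) {δ x : V} (hδ : δ ∈ Δ) (hx : x ∈ Submodule.span ℤ Δ)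
    (hδx : B δ x = 0) :
    (∃ g ∈ transvectionGroup B Δ, ∀ v : V,
        ((g : (V →ₗ[ℚ] V)ˣ) : V →ₗ[ℚ] V) v = v - (2 : ℚ) • (B v x • x)) ↔
    (∃ g ∈ transvectionGroup B Δ, ∀ v : V,
        ((g : (V →ₗ[ℚ] V)ˣ) : V →ₗ[ℚ] V) v = v - (2 : ℚ) • (B v (x + δ) • (x + δ))) := by
  -- the pair move `E_{δ,x}²`, its inverse, and the square `T_δ²`, all realised in `Γ_Δ`
  obtain ⟨y, hy, hδy⟩ := localTubeSpan_squares_step_exists_partner B hB Δ hΔ hδ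
  obtain ⟨p, hp, hpv⟩ := localTubeSpan_pairMoves B hB Δ hΔ hδ hy hδy hx hδx
  obtain ⟨q, hq, hqv⟩ := localTubeSpan_squares_step_pairMove_inv B hB Δ hΔ hδ hx hδx
  obtain ⟨s, hs, hsv⟩ := localTubeSpan_sqMove_of_mem B hB Δ hδ
  have hxδ : B x δ = 0 := by rw [← hB.neg_eq, hδx, neg_zero]
  constructor
  · -- `T_{x+δ}² = T_x² ∘ T_δ² ∘ E_{δ,x}^{-2}`
    rintro ⟨a, ha, hav⟩
    refine ⟨a * s * q, mul_mem (mul_mem ha hs) hq, fun v => ?_⟩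
    rw [Units.val_mul, Units.val_mul, Module.End.mul_apply, Module.End.mul_apply, hqv, hsv, hav]
    simp only [map_add, map_sub, map_smul, LinearMap.add_apply, LinearMap.sub_apply,
      LinearMap.smul_apply, smul_eq_mul, hδx, hxδ, hB.self_eq_zero]
    module
  · -- `T_x² = T_{x+δ}² ∘ T_δ^{-2} ∘ E_{δ,x}²`
    rintro ⟨a, ha, hav⟩
    refine ⟨a * s⁻¹ * p, mul_mem (mul_mem ha (inv_mem hs)) hp, fun v => ?_⟩
    rw [Units.val_mul, Units.val_mul, Module.End.mul_apply, Module.End.mul_apply, hpv,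
      localTubeSpan_sqMove_inv_apply B hB δ s hsv, hav]
    simp only [map_add, map_smul, LinearMap.add_apply, LinearMap.smul_apply, smul_eq_mul, hδx, hxδ,
      hB.self_eq_zero]
    module

end SquaresStep

end Summit.HodgeConjecture.HodgeConjecture.Theorems

end
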